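import Summits.QuantumFields.YangMills.Theorems.BalabanUVNodesN21SlotSupJunction
import Summits.QuantumFields.YangMills.Theorems.BalabanUVNodesN16AtRecord

/-!
# YM-DAG node N21 (= NE7c), THE IN-EDGE N16 → N21 AT THE RECORD CURRENCY: the K4 stub `YMDAG.UVSplit.S_N16 RRec` BY NAME (through N16's
# AT-RECORD face `N16AtRecord.covRoot_at_record`) ⇒ the two-run widths of files 3 ∕ 6 ∕ 7 at the letters of the rate bundle of record `R.ne3`
# — plaquette level, run B's own fine test, and the (2.17) slot `sup` — i.e. road I's rate binder `(C_Q∕ε)·θ^k` READ OFF THE RECORD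

Track A of `YM-PLAN.md` (cell `pub-ymgap`, HUMAN RULING D-0062), node **N21**; seat `pub-ymgap-dag-n21-a`, generation 4, file 9.  Kernel bookkeeping BY
NAME: 0 `def`, 0 `sorry`, standard axioms.  COUNT-NEUTRAL; `--supports` the K5 item.  Written once route module 2 `BalabanUVNodesSpineRates` (p418381:
`NE3Carriers`, `RateCarriers`, `RateRecordPred`, `N16At`, `S_N16`) and N16's AT-RECORD module `BalabanUVNodesN16AtRecord` (p419734: `covRoot_at_record`)
were in the tree.

HONEST FRAMING.  Files 3 ∕ 6 ∕ 7 (p410611 ∕ p414664 ∕ p415145) took N16's statement of record as the RAW hypothesis `hcov : NE3EnergyRateWCov 4 𝒞 L N b g C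
Λ₁ Λ₂′ dom` at free letters.  HERE the same conclusions are stated at the letters of the RATE BUNDLE OF RECORD `R : RateCarriers N` pinned by the K4 record
predicate `RRec` (`RRec F D g₀ os R`), with the in-edge supplied by the K4 STUB `S_N16 RRec` BY NAME — the dependency interface of record of the edge
N16 → N21 in the cluster currency (`N16At R.ne3 = NE3EnergyRateWCov 4 (sfClass 4 L Nper ε) L Nper b g C Λ₁ Λ₂′ dom` at `R.ne3`'s letters).  The END's side
letters (`θ⁶ = L⁻¹`, the regularity numeral `512·5·8·L²·b ≤ 1`, the energy letter `γ` with `C·ρ₄ ≤ γ³` — choosable once per `(L, Nper, g)` by N16's constant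
of record p416870 —, the cube root `l₁` of `Λ₁`, the fit `γ(θ^k)² ≤ l₁Nper`), the two runs' minimisers `U_A`, `U_B` of a datum `V ∈ R.ne3.dom` at levels
`k`, `k+1` in the class `sfClass 4 L Nper ε`, regular (+ `RegularSup` for §3–§4), stay DISPLAYED.  `S_N16 RRec` is NOT proved (no `RRec` home: n16-a
`s_N16_of_pinned` says what a home must carry); NE7c NOT PRINTED, NOT proved; (M1) and the term object untouched; one finite four-torus at fixed `ε`;
NOT continuum ∕ ℝ⁴ ∕ OS ∕ mass gap ∕ Clay.

WHAT IS PROVED ([folklore], each ONE LINE over the cited file BY NAME with `hcov := covRoot_at_record h16 hR`).  §1 `dev_close_at_record` (file 3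
`dev_close_of_n16`: `|‖U_A(∂p) − 1‖ − ‖W(∂p) − 1‖| ≤ C_Q θ^{13k}`, `W = rescale L (bavg L U_B)`); §2 `relWidth_at_record` (file 3 `relWidth_of_n16`: relative
width `≤ (C_Q∕ε′)θ^k` against thresholds `t ≥ ε′(L⁻¹)^{2k}` — road I's `hrate` with `c₁ = C_Q∕ε′`, `ϑ = θ`); §3 `abs_devA_sub_scaledFine_at_record` (file 6
`abs_devA_sub_scaledFine_le_of_n16`: run B read by ITS OWN fine test, `+ E_{k+1}` under `RegularSup`); §4 `abs_slotA_sub_slotB_at_record` (file 7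
`abs_slotA_sub_slotB_le_of_n16`: the (2.17) slot `sup` variables of block-aligned plaquette sets).
-/

set_option autoImplicit false

noncomputable section

open scoped BigOperators Matrix Matrix.Norms.L2Operator

namespace Summit.QuantumFields.YangMills.Theorems.N21ClosenessAtRecord

open Literature.MathematicalPhysics.QuantumFieldTheory.Balaban1983to89
open Literature.MathematicalPhysics.QuantumFieldTheory.Balaban1983to89.T4Continuum (T4Family ULoop)
open B7Prop1Explicit B7Prop2Explicit
open T4AveragingDeficitWall (Plane)
open Summit.QuantumFields.BalabanUV.T4Continuum
open MinimalActionSandwich (IsMinimiser)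
open MinimalActionRate (Regular sfClass)
open MinimalActionRefine (RegularSup)
open AveragingDeficitDualResidual (dualC1 dualC2)
open AveragingDeficitDerivWallProof (wallConst)
open YMDAG.UVSplit (Datum RateCarriers RateRecordPred S_N16)
open Summit.QuantumFields.YangMills.BalabanUVNodes.N16AtRecord (covRoot_at_record)
open N21ClosenessJunction (dev_close_of_n16 relWidth_of_n16)
open N21FineTestJunction (abs_devA_sub_scaledFine_le_of_n16)
open N21SlotSupJunction (abs_slotA_sub_slotB_le_of_n16)

variable {N : ℕ} [NeZero N] {RRec : RateRecordPred N} {F : T4Family} {D : Datum F N} {g₀ : ℕ → ℝ} {os : List (ULoop F)}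
  {R : RateCarriers N} {θ γ l₁ cg : ℝ} {k : ℕ}
  {V UA UB : B7Prop1Explicit.Site 4 → Fin 4 → (Matrix (Fin N) (Fin N) ℂ)ˣ}

/-- `Fin N` is inhabited for `N ≠ 0` (the colour index of `SU(N)`). [folklore] -/
theorem nonempty_fin : Nonempty (Fin N) := ⟨⟨0, Nat.pos_of_ne_zero (NeZero.ne N)⟩⟩

/-! ## §1 Plaquette level: file 3's junction at the record -/

/-- **THE N16 → N21 EDGE AT THE RECORD, PLAQUETTE LEVEL.**  HYPOTHESES: the K4 stub `h16 : S_N16 RRec` BY NAME, a rate bundle of record `hR : RRec F D g₀ os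
R`, the END's side letters at `R.ne3`'s letters (see the module docstring), a level `k ≥ 1` past the fit, a datum `V ∈ R.ne3.dom`, run A's minimiser `U_A` at
level `k` and run B's `U_B` at level `k+1` in the class `sfClass 4 L Nper ε`, `U_B` regular.  CONCLUSION: at EVERY plaquette of run A's lattice the slot
variables `‖U_A(∂p) − 1‖` and `‖W(∂p) − 1‖`, `W = rescale L (bavg L U_B)`, differ by at most `C_Q·θ^{13k}`, `C_Q = 8l₁√(2γΛ₂′) + 1536l₁⁴γ²e^{8l₁²γ}` —
file 3's `dev_close_of_n16` with `hcov := covRoot_at_record h16 hR`.  CONDITIONAL on `S_N16 RRec`. [folklore] -/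
theorem dev_close_at_record (h16 : S_N16 RRec) (hR : RRec F D g₀ os R)
    (hL : 2 ≤ R.ne3.L) (hN : 1 ≤ R.ne3.Nper) (hθ : 0 < θ) (hθ6 : θ ^ 6 = ((R.ne3.L : ℝ))⁻¹) (hb : 0 ≤ R.ne3.b)
    (hbs : 512 * (4 + 1) * (4 + 4) * (R.ne3.L : ℝ) ^ 2 * R.ne3.b ≤ 1) (hg : 0 ≤ R.ne3.g) (hC : 0 ≤ R.ne3.C)
    (hΛ₂' : 0 < R.ne3.Λ₂') (hγ : 0 < γ)
    (hγ3 : R.ne3.C * (wallConst 4 R.ne3.L * (R.ne3.Nper : ℝ) ^ 2 *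
      (Real.sqrt R.ne3.g * dualC2 4 R.ne3.L + 2 * R.ne3.b ^ 2 * dualC1 4 R.ne3.L)) ≤ γ ^ 3)
    (hl₁ : 0 < l₁) (hΛl₁ : R.ne3.Λ₁ ≤ l₁ ^ 3) (hk : 1 ≤ k) (hfit : γ * (θ ^ k) ^ 2 ≤ l₁ * R.ne3.Nper) (hV : V ∈ R.ne3.dom)
    (hA : IsMinimiser 4 (sfClass 4 R.ne3.L R.ne3.Nper R.ne3.ε) R.ne3.L R.ne3.Nper k V UA)
    (hB : IsMinimiser 4 (sfClass 4 R.ne3.L R.ne3.Nper R.ne3.ε) R.ne3.L R.ne3.Nper (k + 1) V UB)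
    (hreg : Regular 4 R.ne3.L R.ne3.Nper R.ne3.b R.ne3.g (k + 1) UB)
    (z : B7Prop1Explicit.Site 4) (μ ν : Fin 4) :
    |‖((hol UA z (plaqWord μ ν) : (Matrix (Fin N) (Fin N) ℂ)ˣ) : Matrix (Fin N) (Fin N) ℂ) - 1‖
        - ‖((hol (rescale R.ne3.L (bavg R.ne3.L UB)) z (plaqWord μ ν) : (Matrix (Fin N) (Fin N) ℂ)ˣ) :
            Matrix (Fin N) (Fin N) ℂ) - 1‖|
      ≤ (8 * l₁ * Real.sqrt (2 * γ * R.ne3.Λ₂') + 1536 * l₁ ^ 4 * γ ^ 2 * Real.exp (8 * l₁ ^ 2 * γ)) * θ ^ (13 * k) :=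
  haveI := nonempty_fin (N := N)
  dev_close_of_n16 hL hN hθ hθ6 hb hbs hg hC hΛ₂' (covRoot_at_record h16 hR) hγ hγ3 hl₁ hΛl₁ hk hfit hV hA hB hreg z μ ν

/-! ## §2 Threshold units: road I's rate binder read off the record -/

/-- **ROAD I's RATE BINDER AT THE RECORD.**  Under the hypotheses of `dev_close_at_record` and for any threshold `t ≥ ε′·(L⁻¹)^{2k}` (`ε′ > 0`), the RELATIVE
two-run width of every plaquette slot variable at level `k` is at most `(C_Q∕ε′)·θ^k` — the in-edge «N16, (F∞): ρ_j ≤ c₁ϑ^j» of road I (file 1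
`n21_knit_levels`, file 8″ `s_N21_of_slotACReading`) with `c₁ = C_Q∕ε′`, `ϑ = θ = L^{−1∕6}`, now CONDITIONAL on the K4 stub `S_N16 RRec` by name
(file 3's `relWidth_of_n16`). [folklore] -/
theorem relWidth_at_record (h16 : S_N16 RRec) (hR : RRec F D g₀ os R)
    (hL : 2 ≤ R.ne3.L) (hN : 1 ≤ R.ne3.Nper) (hθ : 0 < θ) (hθ6 : θ ^ 6 = ((R.ne3.L : ℝ))⁻¹) (hb : 0 ≤ R.ne3.b)
    (hbs : 512 * (4 + 1) * (4 + 4) * (R.ne3.L : ℝ) ^ 2 * R.ne3.b ≤ 1) (hg : 0 ≤ R.ne3.g) (hC : 0 ≤ R.ne3.C)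
    (hΛ₂' : 0 < R.ne3.Λ₂') (hγ : 0 < γ)
    (hγ3 : R.ne3.C * (wallConst 4 R.ne3.L * (R.ne3.Nper : ℝ) ^ 2 *
      (Real.sqrt R.ne3.g * dualC2 4 R.ne3.L + 2 * R.ne3.b ^ 2 * dualC1 4 R.ne3.L)) ≤ γ ^ 3)
    (hl₁ : 0 < l₁) (hΛl₁ : R.ne3.Λ₁ ≤ l₁ ^ 3) (hk : 1 ≤ k) (hfit : γ * (θ ^ k) ^ 2 ≤ l₁ * R.ne3.Nper) (hV : V ∈ R.ne3.dom)
    (hA : IsMinimiser 4 (sfClass 4 R.ne3.L R.ne3.Nper R.ne3.ε) R.ne3.L R.ne3.Nper k V UA)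
    (hB : IsMinimiser 4 (sfClass 4 R.ne3.L R.ne3.Nper R.ne3.ε) R.ne3.L R.ne3.Nper (k + 1) V UB)
    (hreg : Regular 4 R.ne3.L R.ne3.Nper R.ne3.b R.ne3.g (k + 1) UB)
    {ε' t : ℝ} (hε' : 0 < ε') (ht : ε' * ((R.ne3.L : ℝ)⁻¹) ^ (2 * k) ≤ t) (z : B7Prop1Explicit.Site 4) (μ ν : Fin 4) :
    |‖((hol UA z (plaqWord μ ν) : (Matrix (Fin N) (Fin N) ℂ)ˣ) : Matrix (Fin N) (Fin N) ℂ) - 1‖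
        - ‖((hol (rescale R.ne3.L (bavg R.ne3.L UB)) z (plaqWord μ ν) : (Matrix (Fin N) (Fin N) ℂ)ˣ) :
            Matrix (Fin N) (Fin N) ℂ) - 1‖| / t
      ≤ (8 * l₁ * Real.sqrt (2 * γ * R.ne3.Λ₂') + 1536 * l₁ ^ 4 * γ ^ 2 * Real.exp (8 * l₁ ^ 2 * γ)) / ε' * θ ^ k :=
  haveI := nonempty_fin (N := N)
  relWidth_of_n16 hL hN hθ hθ6 hb hbs hg hC hΛ₂' (covRoot_at_record h16 hR) hγ hγ3 hl₁ hΛl₁ hk hfit hV hA hB hreg hε' ht z μ ν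

/-! ## §3 Run B read by ITS OWN fine test: file 6's junction at the record -/

/-- **THE EDGE AT THE RECORD, AT RUN B's OWN FINE TEST.**  Under the hypotheses of `dev_close_at_record` PLUS `hsup : RegularSup 4 L Nper b cg (k+1) U_B`
(the sup form of [B11] Thm 1 (10), N16 ∕ N07 species): for every coarse plaquette at `z` in the plane `π` and EVERY fine stencil plaquette
`L·z + boxVec L r₀ + i₀e_μ + j₀e_ν`, `|‖U_A(∂p′) − 1‖ − L²‖U_B(∂p₀) − 1‖| ≤ C_Qθ^{13k} + E_{k+1}` — file 6's `abs_devA_sub_scaledFine_le_of_n16` with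
`hcov := covRoot_at_record h16 hR`. [folklore] -/
theorem abs_devA_sub_scaledFine_at_record (h16 : S_N16 RRec) (hR : RRec F D g₀ os R)
    (hL : 2 ≤ R.ne3.L) (hN : 1 ≤ R.ne3.Nper) (hθ : 0 < θ) (hθ6 : θ ^ 6 = ((R.ne3.L : ℝ))⁻¹) (hb : 0 ≤ R.ne3.b)
    (hbs : 512 * (4 + 1) * (4 + 4) * (R.ne3.L : ℝ) ^ 2 * R.ne3.b ≤ 1) (hg : 0 ≤ R.ne3.g) (hC : 0 ≤ R.ne3.C)
    (hΛ₂' : 0 < R.ne3.Λ₂') (hγ : 0 < γ)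
    (hγ3 : R.ne3.C * (wallConst 4 R.ne3.L * (R.ne3.Nper : ℝ) ^ 2 *
      (Real.sqrt R.ne3.g * dualC2 4 R.ne3.L + 2 * R.ne3.b ^ 2 * dualC1 4 R.ne3.L)) ≤ γ ^ 3)
    (hl₁ : 0 < l₁) (hΛl₁ : R.ne3.Λ₁ ≤ l₁ ^ 3) (hk : 1 ≤ k) (hfit : γ * (θ ^ k) ^ 2 ≤ l₁ * R.ne3.Nper) (hV : V ∈ R.ne3.dom)
    (hA : IsMinimiser 4 (sfClass 4 R.ne3.L R.ne3.Nper R.ne3.ε) R.ne3.L R.ne3.Nper k V UA)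
    (hB : IsMinimiser 4 (sfClass 4 R.ne3.L R.ne3.Nper R.ne3.ε) R.ne3.L R.ne3.Nper (k + 1) V UB)
    (hreg : Regular 4 R.ne3.L R.ne3.Nper R.ne3.b R.ne3.g (k + 1) UB)
    (hsup : RegularSup 4 R.ne3.L R.ne3.Nper R.ne3.b cg (k + 1) UB)
    (z : B7Prop1Explicit.Site 4) (π : Plane 4) (r₀ : Fin 4 → Fin R.ne3.L) {i₀ j₀ : ℕ} (hi₀ : i₀ < R.ne3.L) (hj₀ : j₀ < R.ne3.L) :
    |‖((hol UA z (plaqWord π.1.1 π.1.2) : (Matrix (Fin N) (Fin N) ℂ)ˣ) : Matrix (Fin N) (Fin N) ℂ) - 1‖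
        - (R.ne3.L : ℝ) ^ 2 * ‖((hol UB ((R.ne3.L : ℤ) • z + boxVec R.ne3.L r₀ + (i₀ : ℤ) • e π.1.1 + (j₀ : ℤ) • e π.1.2)
            (plaqWord π.1.1 π.1.2) : (Matrix (Fin N) (Fin N) ℂ)ˣ) : Matrix (Fin N) (Fin N) ℂ) - 1‖|
      ≤ (8 * l₁ * Real.sqrt (2 * γ * R.ne3.Λ₂') + 1536 * l₁ ^ 4 * γ ^ 2 * Real.exp (8 * l₁ ^ 2 * γ)) * θ ^ (13 * k)
        + ((R.ne3.L : ℝ) ^ 2 * (((2 * (4 * R.ne3.L) + 4 * R.ne3.L : ℕ) : ℝ)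
          * (cg / ((R.ne3.L : ℝ) ^ (k + 1)) ^ 3 * Real.exp (2 * (R.ne3.b / ((R.ne3.L : ℝ) ^ (k + 1)) ^ 2))
            + 2 * (((3 * (4 * R.ne3.L) + 8 * R.ne3.L : ℕ) : ℝ) * (R.ne3.b / ((R.ne3.L : ℝ) ^ (k + 1)) ^ 2))
              * (R.ne3.b / ((R.ne3.L : ℝ) ^ (k + 1)) ^ 2)))
        + 226 * (8 * ((4 : ℕ) + 1 : ℝ) * ((4 : ℕ) + 4 : ℝ) * (R.ne3.L : ℝ) ^ 2 * (R.ne3.b / ((R.ne3.L : ℝ) ^ (k + 1)) ^ 2)) ^ 2) :=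
  haveI := nonempty_fin (N := N)
  abs_devA_sub_scaledFine_le_of_n16 hL hN hθ hθ6 hb hbs hg hC hΛ₂' (covRoot_at_record h16 hR) hγ hγ3 hl₁ hΛl₁ hk hfit hV hA hB
    hreg hsup z π r₀ hi₀ hj₀

/-! ## §4 The (2.17) SLOT variables (cube `sup`): file 7's junction at the record -/

/-- **THE EDGE AT THE RECORD, SLOT LEVEL.**  Under the hypotheses of `abs_devA_sub_scaledFine_at_record`, for every BLOCK-ALIGNED pair of nonempty
finite plaquette sets `I` (coarse) and `J` (fine) — `L·I ⊆ J` and every `w ∈ J` decomposes as `L·x + boxVec L r` with `x ∈ I` —: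
`|max_I ‖U_A(∂p) − 1‖ − max_J L²‖U_B(∂p) − 1‖| ≤ C_Qθ^{13k} + E_{k+1}`: the (2.17) slot indicators of the two runs, run B read by ITS OWN slot test,
differ on single-run shells of the slot `sup` variables — file 7's `abs_slotA_sub_slotB_le_of_n16` with `hcov := covRoot_at_record h16 hR`. [folklore] -/
theorem abs_slotA_sub_slotB_at_record (h16 : S_N16 RRec) (hR : RRec F D g₀ os R)
    (hL : 2 ≤ R.ne3.L) (hN : 1 ≤ R.ne3.Nper) (hθ : 0 < θ) (hθ6 : θ ^ 6 = ((R.ne3.L : ℝ))⁻¹) (hb : 0 ≤ R.ne3.b)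
    (hbs : 512 * (4 + 1) * (4 + 4) * (R.ne3.L : ℝ) ^ 2 * R.ne3.b ≤ 1) (hg : 0 ≤ R.ne3.g) (hC : 0 ≤ R.ne3.C)
    (hΛ₂' : 0 < R.ne3.Λ₂') (hγ : 0 < γ)
    (hγ3 : R.ne3.C * (wallConst 4 R.ne3.L * (R.ne3.Nper : ℝ) ^ 2 *
      (Real.sqrt R.ne3.g * dualC2 4 R.ne3.L + 2 * R.ne3.b ^ 2 * dualC1 4 R.ne3.L)) ≤ γ ^ 3)
    (hl₁ : 0 < l₁) (hΛl₁ : R.ne3.Λ₁ ≤ l₁ ^ 3) (hk : 1 ≤ k) (hfit : γ * (θ ^ k) ^ 2 ≤ l₁ * R.ne3.Nper) (hV : V ∈ R.ne3.dom)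
    (hA : IsMinimiser 4 (sfClass 4 R.ne3.L R.ne3.Nper R.ne3.ε) R.ne3.L R.ne3.Nper k V UA)
    (hB : IsMinimiser 4 (sfClass 4 R.ne3.L R.ne3.Nper R.ne3.ε) R.ne3.L R.ne3.Nper (k + 1) V UB)
    (hreg : Regular 4 R.ne3.L R.ne3.Nper R.ne3.b R.ne3.g (k + 1) UB)
    (hsup : RegularSup 4 R.ne3.L R.ne3.Nper R.ne3.b cg (k + 1) UB) (π : Plane 4)
    {I J : Finset (B7Prop1Explicit.Site 4)} (hI : I.Nonempty) (hJ : J.Nonempty)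
    (hIJ : ∀ x ∈ I, (R.ne3.L : ℤ) • x ∈ J)
    (hJI : ∀ w ∈ J, ∀ (x : B7Prop1Explicit.Site 4) (r : Fin 4 → Fin R.ne3.L), w = (R.ne3.L : ℤ) • x + boxVec R.ne3.L r → x ∈ I) :
    |I.sup' hI (fun x => ‖((hol UA x (plaqWord π.1.1 π.1.2) : (Matrix (Fin N) (Fin N) ℂ)ˣ) : Matrix (Fin N) (Fin N) ℂ) - 1‖)
        - J.sup' hJ (fun w => (R.ne3.L : ℝ) ^ 2 *
            ‖((hol UB w (plaqWord π.1.1 π.1.2) : (Matrix (Fin N) (Fin N) ℂ)ˣ) : Matrix (Fin N) (Fin N) ℂ) - 1‖)|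
      ≤ (8 * l₁ * Real.sqrt (2 * γ * R.ne3.Λ₂') + 1536 * l₁ ^ 4 * γ ^ 2 * Real.exp (8 * l₁ ^ 2 * γ)) * θ ^ (13 * k)
        + ((R.ne3.L : ℝ) ^ 2 * (((2 * (4 * R.ne3.L) + 4 * R.ne3.L : ℕ) : ℝ)
          * (cg / ((R.ne3.L : ℝ) ^ (k + 1)) ^ 3 * Real.exp (2 * (R.ne3.b / ((R.ne3.L : ℝ) ^ (k + 1)) ^ 2))
            + 2 * (((3 * (4 * R.ne3.L) + 8 * R.ne3.L : ℕ) : ℝ) * (R.ne3.b / ((R.ne3.L : ℝ) ^ (k + 1)) ^ 2))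
              * (R.ne3.b / ((R.ne3.L : ℝ) ^ (k + 1)) ^ 2)))
        + 226 * (8 * ((4 : ℕ) + 1 : ℝ) * ((4 : ℕ) + 4 : ℝ) * (R.ne3.L : ℝ) ^ 2 * (R.ne3.b / ((R.ne3.L : ℝ) ^ (k + 1)) ^ 2)) ^ 2) :=
  haveI := nonempty_fin (N := N)
  abs_slotA_sub_slotB_le_of_n16 hL hN hθ hθ6 hb hbs hg hC hΛ₂' (covRoot_at_record h16 hR) hγ hγ3 hl₁ hΛl₁ hk hfit hV hA hB
    hreg hsup π hI hJ hIJ hJI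

end Summit.QuantumFields.YangMills.Theorems.N21ClosenessAtRecord

end
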